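import Summits.QuantumFields.BalabanUV.Beta.D1BFx.ChartDefectHeadRepaired

/-!
# `BalabanUV.Beta.D1BFx.ChartDefectHeadEnd` — road «BF-x», binder row D1, PART 24-hyb HEAD: **THE END ADAPTER** — the (J1) binder `hC₁` of
# `RoadEndBFxHybS.d1Rep_BFx_hyb_sbpS` (∕ `RoadEndBFxRoadScalesJ1RowS`) VERBATIM, from the FIVE priced rows of `ChartDefectHeadRepaired` §2.

WHAT IT TYPES.  `hC₁` reads, for every `m ≥ 1`, `|secondMoment (c e z ↦ TshotOf Lc Jc m c e z − hessKer G₀(r) (vertexOfK G₀(r) (Lc^m) (S (Lc^m))) (vertex2OfK G₀(r) (Lc^m) (S₂ (Lc^m))) c e z) μ ν| ≤ CJ1`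
with `G₀(r) := coDressKBmAt (toSite (r (Lc^m))) (Lc^m) (KInvStep (Lc^m) 0)`, the block roots `r` PINNED by `hrpin : ∀ n, r n = ctrOff 4 n`, the literal's first-order
family `S` PINNED by `hSpin` to the odd-indexed dif-family of the RAW (III′) member with the locks read through `Nat.log Lc` (R-D1-g43-3 (2)), and `Jc`, `S₂` the caller's.
HERE: `Jc := JcOfTabs hLc N (k ↦ symTablesAn1S2 3 (Lc^k) (cΛ k)) cΛ cB` (an1's tables), lockB `hcB : ∀ k, cB k = −(Lc^k)¹²∕4`, `S₂ (Lc^m) :=` the record's pair table at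
`Lc^m`, and the five rows (lead)(rest)(mcol)(ms)(lamf) priced m-uniformly (HYPOTHESES, pins as in `ChartDefectHeadRepaired` §2) ⟹ `hC₁` with `CJ1 := Clead + Crest + Cmcol + Cms + Clamf`
— `theorem hC1_of_five_rows`.  Plumbing only: `hrpin`, `dif_pos hLc.pow`, `Nat.log_pow`, `hcB`, then `abs_secondMoment_chartDefect_scales_le_of_five_rows`.

HONEST DEPENDENCY (cell records, verbatim): «continuum YM on T⁴ ⇐ BetaPertH ∧ nine spine estimates (0/9 proved); BetaPertH ⇐ (D1) ∧ (D4) ∧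
CAP+tail; G-an2-4 gates asym, D1 and NE2/3/4.»  HONEST FRAMING (cell contract, verbatim): «discharging `BetaPertH` makes Bałaban's UV stability
UNCONDITIONAL — a real constructive-QFT result; it is NOT the continuum limit and NOT the Clay problem.»  THIS MODULE DISCHARGES NO binder of row D1 and
NO estimate of Bałaban's: [folklore] binder bookkeeping; the five rows are HYPOTHESES (none priced in the tree); colour data HYPOTHESES; no definition, no
`def … : Prop`, nothing cited, 0 sorry; one `set_option maxHeartbeats 400000 in` (statement elaboration of the scale-instantiated pins, as in `ChartDefectHeadScales`).
0∕4 row-D1 binders; (K) NOT closed; (J1) ONE OPEN ROW `hC₁` — HERE REDUCED TO FIVE DISPLAYED m-UNIFORM ROW PRICES, none in the tree; NOT D1, NEVER «G-an2-4 closed»,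
NOT `BetaPertH`, NOT continuum, NOT Clay.

ABSOLUTE RULE (cell charter, verbatim): «No internally-minted statement may enter as a cited fact. Every hypothesis is either kernel-proved in this
package or a verbatim quotation of a PUBLISHED theorem with page reference. The manuscript(s) under audit are NOT citable for their own disputed
steps — they are the thing under adjudication; programme-internal (2001/route/tribunal) claims are never citable.»

Unit `b2b-balaban-beta-d1-p2` (road owner, gen 26), 2026-08-24; no existing file touched.
-/

noncomputable section

namespace Summit.QuantumFields.BalabanUV.Beta.D1BFx.ChartDefectHeadEnd

open Finset
open scoped BigOperators
open Literature.MathematicalPhysics.QuantumFieldTheory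
open Literature.MathematicalPhysics.QuantumFieldTheory.Balaban1983to89
open Literature.MathematicalPhysics.QuantumFieldTheory.Balaban1983to89.Beta
open Literature.MathematicalPhysics.QuantumFieldTheory.Balaban1983to89.B12Beta (secondMoment)
open Literature.MathematicalPhysics.QuantumFieldTheory.Balaban1983to89.Beta.DecimatedMomentSummable (AbsMoment₂)
open ColourTrace (Complete TrOrthonormal)
open WilsonVertex2Sym (wsym22)
open WilsonBiStencil (wilsonW₂)
open StepJetData (wilsonA)
open ExpKernelCalculus (MKer comp tr tadpole bubble hessKer)
open OneStepResolventKernel (Fib TOf)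
open OneStepKernelFamily (colH vertexOfK KInvStep TshotOf)
open SecondOrderResponse (vertexOfM mixOfK W2SymOfK vertex2OfK)
open BalabanStepW2 (M2Of)
open AffineAveraging (Site toSite)
open AveragingContours (blk)
open AveragingContoursRooted (ctr ctrOff)
open Summit.QuantumFields.BalabanUV.Beta.BorderedHessian (diagK)
open Summit.QuantumFields.BalabanUV.Beta.DshAn1 (Dsh)
open Summit.QuantumFields.BalabanUV.Beta.AxialDressingRooted (coDressKBmAt)
open Summit.QuantumFields.BalabanUV.Beta.AxialProjectorBlockMean (bmGaugeAt)
open Summit.QuantumFields.BalabanUV.Beta.AveragingWardRootedStencils (legSite)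
open Summit.QuantumFields.BalabanUV.Beta.SymAveragingHessianCounts (symVhSAt symHessFFAt)
open Summit.QuantumFields.BalabanUV.Beta.SymSecondOrderTablesAn1 (symVh₂SAn1 symTablesAn1S2)
open Summit.QuantumFields.BalabanUV.Beta.CombChartStepJets (GcombSh JsB12CombSh0)
open Summit.QuantumFields.BalabanUV.Beta.CombChartJointEnd (JsB12CombShSym)
open Summit.QuantumFields.BalabanUV.Beta.CombOneShotJetsTabs (JcOfTabs)
open Summit.QuantumFields.BalabanUV.Beta.CompositeCorrectorLocality (blockSitesF)
open Summit.QuantumFields.BalabanUV.Beta.SymCorrectorFace (faceWt)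
open Summit.QuantumFields.BalabanUV.Beta.D1BFx.ChartDefectHeadRepaired (abs_secondMoment_chartDefect_scales_le_of_five_rows)

variable {Lc : ℕ} [NeZero Lc] {N : ℕ} {C : Type*} [Fintype C] [DecidableEq C] {τ : C → Matrix (Fin N) (Fin N) ℂ}

set_option maxHeartbeats 400000 in
/-- **THE (J1) BINDER `hC₁` FROM FIVE PRICED ROWS** [folklore binder bookkeeping].  For `Lc` odd, `2 ≤ Lc`, an1's tables with lockB (`hcB`), block roots `r`
pinned to `ctrOff` (`hrpin`) and the literal's first-order family `S` pinned to the odd-indexed dif-family of the raw (III′) member (`hSpin`, locks through `Nat.log Lc` —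
`RoadEndBFxHybS.d1Rep_BFx_hyb_sbpS`'s binders VERBATIM with `Nlit := N`, `cΛlit := cΛ`, `cBlit := cB`): if the five row kernels of `ChartDefectHeadRepaired` §2 are priced
with m-INDEPENDENT constants, then for every `m ≥ 1` the (J1) row holds with `CJ1 := Clead + Crest + Cmcol + Cms + Clamf` — at `Jc := JcOfTabs hLc N (k ↦ symTablesAn1S2 3 (Lc^k) (cΛ k)) cΛ cB`
and the record's pair table at `Lc^m`.  Proof: `hrpin`, `dif_pos hLc.pow`, `Nat.log_pow`, `hcB`, §2.  No row is priced here. -/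
theorem hC1_of_five_rows (hLc : Odd Lc) (hL : 2 ≤ Lc) (hτ : Complete τ) (ho : TrOrthonormal τ) (hN : N ≠ 0) (c : C) (cΛ cB : ℕ → ℝ)
    (hcB : ∀ k : ℕ, cB k = -(((Lc ^ k : ℕ) : ℝ) ^ 12 / 4)) (μ ν : Fin 4)
    -- the END's per-scale block roots and first-order family, PINNED as in `RoadEndBFxHybS.d1Rep_BFx_hyb_sbpS`
    (r : ℕ → Fin 4 → ℕ) (hrpin : ∀ n : ℕ, r n = ctrOff 4 n)
    (S : ℕ → Fin 4 → (Fin 4 → ℤ) → MKer 4 (Fib 3))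
    (hSpin : S = (fun n : ℕ => if h : Odd n then (haveI : NeZero n := ⟨h.pos.ne'⟩;
        (JsB12CombSh0 (Lc := n) h N (symTablesAn1S2 3 n (cΛ (Nat.log Lc n))) (cΛ (Nat.log Lc n)) (cB (Nat.log Lc n)) 0).S) else 0))
    -- the five rows of `ChartDefectHeadRepaired` §2, per scale, with their pins
    (Wlead Wrest Wmcol Wms Wlamf : ℕ → Fin 4 → Fin 4 → Site 4 → ℝ)
    (hWlead : ∀ (m : ℕ) (μ₀ ν₀ : Fin 4) (z₀ : Site 4), Wlead m μ₀ ν₀ z₀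
      = ((-((1 / 2) * tr (comp (comp (comp (coDressKBmAt (ctr 4 (Lc ^ m)) (Lc ^ m) (KInvStep (d := 3) (Lc ^ m) 0)) (Dsh (Lc ^ m))) (GcombSh (d := 3) (Lc ^ m) 0)) (W2SymOfK (KInvStep (d := 3) (Lc ^ m) 0) (Lc ^ m) (fun κ u => (((Lc ^ m : ℕ) : ℝ) ^ 4) • wilsonA 3 κ u + (-(((Lc ^ m : ℕ) : ℝ) ^ 8 / 2)) • symVhSAt (ctr 4 (Lc ^ m)) 3 (Lc ^ m) rfl κ u)
              ((symTablesAn1S2 3 (Lc ^ m) (cΛ m)).M 0) (fun κ u κ' u' => (((Lc ^ m : ℕ) : ℝ) ^ 8) • wilsonW₂ 3 ((8 * (N : ℝ) ^ 2)⁻¹ • wsym22 N) κ u κ' u' + (-(((Lc ^ m : ℕ) : ℝ) ^ 12 / 4)) • symVh₂SAn1 3 (Lc ^ m) κ u κ' u')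
              (M2Of 3 (Lc ^ m) (symTablesAn1S2 3 (Lc ^ m) (cΛ m)).mixFF 0) μ₀ 0 ν₀ z₀
          + ((((comp (diagK fun z' b => ((Lc ^ m : ℕ) : ℝ) ^ 4 / 2 * bmGaugeAt (ctr 4 (Lc ^ m)) (colH (KInvStep (d := 3) (Lc ^ m) 0) (Lc ^ m) ν₀ z₀) (Lc ^ m) (legSite (ctr 4 (Lc ^ m)) z' b)) (vertexOfK (KInvStep (d := 3) (Lc ^ m) 0) (Lc ^ m) (fun κ u => (((Lc ^ m : ℕ) : ℝ) ^ 4) • wilsonA 3 κ u + (-(((Lc ^ m : ℕ) : ℝ) ^ 8 / 2)) • symVhSAt (ctr 4 (Lc ^ m)) 3 (Lc ^ m) rfl κ u) μ₀ 0)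
                - comp (vertexOfK (KInvStep (d := 3) (Lc ^ m) 0) (Lc ^ m) (fun κ u => (((Lc ^ m : ℕ) : ℝ) ^ 4) • wilsonA 3 κ u + (-(((Lc ^ m : ℕ) : ℝ) ^ 8 / 2)) • symVhSAt (ctr 4 (Lc ^ m)) 3 (Lc ^ m) rfl κ u) μ₀ 0) (diagK fun z' b => ((Lc ^ m : ℕ) : ℝ) ^ 4 / 2 * bmGaugeAt (ctr 4 (Lc ^ m)) (colH (KInvStep (d := 3) (Lc ^ m) 0) (Lc ^ m) ν₀ z₀) (Lc ^ m) (legSite (ctr 4 (Lc ^ m)) z' b)))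
              + (comp (diagK fun z' b => ((Lc ^ m : ℕ) : ℝ) ^ 4 / 2 * bmGaugeAt (ctr 4 (Lc ^ m)) (colH (KInvStep (d := 3) (Lc ^ m) 0) (Lc ^ m) μ₀ 0) (Lc ^ m) (legSite (ctr 4 (Lc ^ m)) z' b)) (vertexOfK (KInvStep (d := 3) (Lc ^ m) 0) (Lc ^ m) (fun κ u => (((Lc ^ m : ℕ) : ℝ) ^ 4) • wilsonA 3 κ u + (-(((Lc ^ m : ℕ) : ℝ) ^ 8 / 2)) • symVhSAt (ctr 4 (Lc ^ m)) 3 (Lc ^ m) rfl κ u) ν₀ z₀)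
                - comp (vertexOfK (KInvStep (d := 3) (Lc ^ m) 0) (Lc ^ m) (fun κ u => (((Lc ^ m : ℕ) : ℝ) ^ 4) • wilsonA 3 κ u + (-(((Lc ^ m : ℕ) : ℝ) ^ 8 / 2)) • symVhSAt (ctr 4 (Lc ^ m)) 3 (Lc ^ m) rfl κ u) ν₀ z₀) (diagK fun z' b => ((Lc ^ m : ℕ) : ℝ) ^ 4 / 2 * bmGaugeAt (ctr 4 (Lc ^ m)) (colH (KInvStep (d := 3) (Lc ^ m) 0) (Lc ^ m) μ₀ 0) (Lc ^ m) (legSite (ctr 4 (Lc ^ m)) z' b)))))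
            - (((comp (diagK fun z' b => ((Lc ^ m : ℕ) : ℝ) ^ 4 / 2 * bmGaugeAt (ctr 4 (Lc ^ m)) (colH (KInvStep (d := 3) (Lc ^ m) 0) (Lc ^ m) ν₀ z₀) (Lc ^ m) (legSite (ctr 4 (Lc ^ m)) z' b)) (vertexOfK (KInvStep (d := 3) (Lc ^ m) 0) (Lc ^ m) (JsB12CombSh0 (Lc := Lc ^ m) hLc.pow N (symTablesAn1S2 3 (Lc ^ m) (cΛ m)) (cΛ m) (-(((Lc ^ m : ℕ) : ℝ) ^ 12 / 4)) 0).S μ₀ 0)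
                - comp (vertexOfK (KInvStep (d := 3) (Lc ^ m) 0) (Lc ^ m) (JsB12CombSh0 (Lc := Lc ^ m) hLc.pow N (symTablesAn1S2 3 (Lc ^ m) (cΛ m)) (cΛ m) (-(((Lc ^ m : ℕ) : ℝ) ^ 12 / 4)) 0).S μ₀ 0) (diagK fun z' b => ((Lc ^ m : ℕ) : ℝ) ^ 4 / 2 * bmGaugeAt (ctr 4 (Lc ^ m)) (colH (KInvStep (d := 3) (Lc ^ m) 0) (Lc ^ m) ν₀ z₀) (Lc ^ m) (legSite (ctr 4 (Lc ^ m)) z' b)))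
              + (comp (diagK fun z' b => ((Lc ^ m : ℕ) : ℝ) ^ 4 / 2 * bmGaugeAt (ctr 4 (Lc ^ m)) (colH (KInvStep (d := 3) (Lc ^ m) 0) (Lc ^ m) μ₀ 0) (Lc ^ m) (legSite (ctr 4 (Lc ^ m)) z' b)) (vertexOfK (KInvStep (d := 3) (Lc ^ m) 0) (Lc ^ m) (JsB12CombSh0 (Lc := Lc ^ m) hLc.pow N (symTablesAn1S2 3 (Lc ^ m) (cΛ m)) (cΛ m) (-(((Lc ^ m : ℕ) : ℝ) ^ 12 / 4)) 0).S ν₀ z₀)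
                - comp (vertexOfK (KInvStep (d := 3) (Lc ^ m) 0) (Lc ^ m) (JsB12CombSh0 (Lc := Lc ^ m) hLc.pow N (symTablesAn1S2 3 (Lc ^ m) (cΛ m)) (cΛ m) (-(((Lc ^ m : ℕ) : ℝ) ^ 12 / 4)) 0).S ν₀ z₀) (diagK fun z' b => ((Lc ^ m : ℕ) : ℝ) ^ 4 / 2 * bmGaugeAt (ctr 4 (Lc ^ m)) (colH (KInvStep (d := 3) (Lc ^ m) 0) (Lc ^ m) μ₀ 0) (Lc ^ m) (legSite (ctr 4 (Lc ^ m)) z' b))))))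
          + ((mixOfK (coDressKBmAt (ctr 4 (Lc ^ m)) (Lc ^ m) (KInvStep (d := 3) (Lc ^ m) 0)) (Lc ^ m) (M2Of 3 (Lc ^ m) (symTablesAn1S2 3 (Lc ^ m) (cΛ m)).mixFF 0) μ₀ 0 ν₀ z₀
                - mixOfK (KInvStep (d := 3) (Lc ^ m) 0) (Lc ^ m) (M2Of 3 (Lc ^ m) (symTablesAn1S2 3 (Lc ^ m) (cΛ m)).mixFF 0) μ₀ 0 ν₀ z₀)
            + (mixOfK (coDressKBmAt (ctr 4 (Lc ^ m)) (Lc ^ m) (KInvStep (d := 3) (Lc ^ m) 0)) (Lc ^ m) (M2Of 3 (Lc ^ m) (symTablesAn1S2 3 (Lc ^ m) (cΛ m)).mixFF 0) ν₀ z₀ μ₀ 0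
                - mixOfK (KInvStep (d := 3) (Lc ^ m) 0) (Lc ^ m) (M2Of 3 (Lc ^ m) (symTablesAn1S2 3 (Lc ^ m) (cΛ m)).mixFF 0) ν₀ z₀ μ₀ 0))
          + (((mixOfK (coDressKBmAt (ctr 4 (Lc ^ m)) (Lc ^ m) (KInvStep (d := 3) (Lc ^ m) 0)) (Lc ^ m) (fun κ u ρ w => (if blk (Lc ^ m) (((Lc ^ m : ℕ) : ℤ) • w + (ctr 4 (Lc ^ m))) = blk (Lc ^ m) u then 2 * faceWt (ctrOff 4 (Lc ^ m)) (Lc ^ m) κ u else 0) • (symHessFFAt (ctr 4 (Lc ^ m)) (Lc ^ m)) ρ w) μ₀ 0 ν₀ z₀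
                + mixOfK (coDressKBmAt (ctr 4 (Lc ^ m)) (Lc ^ m) (KInvStep (d := 3) (Lc ^ m) 0)) (Lc ^ m) (fun κ u ρ w => (if blk (Lc ^ m) (((Lc ^ m : ℕ) : ℤ) • w + (ctr 4 (Lc ^ m))) = blk (Lc ^ m) u then 2 * faceWt (ctrOff 4 (Lc ^ m)) (Lc ^ m) κ u else 0) • (symHessFFAt (ctr 4 (Lc ^ m)) (Lc ^ m)) ρ w) ν₀ z₀ μ₀ 0)
              - (comp (diagK fun z b => ∑ α : Fin (3 + 1), ∑ x ∈ blockSitesF (Lc ^ m) (blk (Lc ^ m) (legSite (ctr 4 (Lc ^ m)) z b)), colH (coDressKBmAt (ctr 4 (Lc ^ m)) (Lc ^ m) (KInvStep (d := 3) (Lc ^ m) 0)) (Lc ^ m) μ₀ 0 α x * (2 * faceWt (ctrOff 4 (Lc ^ m)) (Lc ^ m) α x)) (vertexOfM (coDressKBmAt (ctr 4 (Lc ^ m)) (Lc ^ m) (KInvStep (d := 3) (Lc ^ m) 0)) (Lc ^ m) (symHessFFAt (ctr 4 (Lc ^ m)) (Lc ^ m)) ν₀ z₀)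
                + comp (diagK fun z b => ∑ α : Fin (3 + 1), ∑ x ∈ blockSitesF (Lc ^ m) (blk (Lc ^ m) (legSite (ctr 4 (Lc ^ m)) z b)), colH (coDressKBmAt (ctr 4 (Lc ^ m)) (Lc ^ m) (KInvStep (d := 3) (Lc ^ m) 0)) (Lc ^ m) ν₀ z₀ α x * (2 * faceWt (ctrOff 4 (Lc ^ m)) (Lc ^ m) α x)) (vertexOfM (coDressKBmAt (ctr 4 (Lc ^ m)) (Lc ^ m) (KInvStep (d := 3) (Lc ^ m) 0)) (Lc ^ m) (symHessFFAt (ctr 4 (Lc ^ m)) (Lc ^ m)) μ₀ 0)))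
          + ((((comp (diagK fun z b => -(∑ α : Fin (3 + 1), ∑ x ∈ blockSitesF (Lc ^ m) (blk (Lc ^ m) (legSite (ctr 4 (Lc ^ m)) z b)), colH (coDressKBmAt (ctr 4 (Lc ^ m)) (Lc ^ m) (KInvStep (d := 3) (Lc ^ m) 0)) (Lc ^ m) ν₀ z₀ α x * ((((Lc ^ m : ℕ) : ℝ) ^ 4 / 2) * faceWt (ctrOff 4 (Lc ^ m)) (Lc ^ m) α x))) (vertexOfK (coDressKBmAt (ctr 4 (Lc ^ m)) (Lc ^ m) (KInvStep (d := 3) (Lc ^ m) 0)) (Lc ^ m) (fun κ u => (((Lc ^ m : ℕ) : ℝ) ^ 4) • wilsonA 3 κ u + (-(((Lc ^ m : ℕ) : ℝ) ^ 8 / 2)) • symVhSAt (ctr 4 (Lc ^ m)) 3 (Lc ^ m) rfl κ u) μ₀ 0)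
                - comp (vertexOfK (coDressKBmAt (ctr 4 (Lc ^ m)) (Lc ^ m) (KInvStep (d := 3) (Lc ^ m) 0)) (Lc ^ m) (fun κ u => (((Lc ^ m : ℕ) : ℝ) ^ 4) • wilsonA 3 κ u + (-(((Lc ^ m : ℕ) : ℝ) ^ 8 / 2)) • symVhSAt (ctr 4 (Lc ^ m)) 3 (Lc ^ m) rfl κ u) μ₀ 0) (diagK fun z b => -(∑ α : Fin (3 + 1), ∑ x ∈ blockSitesF (Lc ^ m) (blk (Lc ^ m) (legSite (ctr 4 (Lc ^ m)) z b)), colH (coDressKBmAt (ctr 4 (Lc ^ m)) (Lc ^ m) (KInvStep (d := 3) (Lc ^ m) 0)) (Lc ^ m) ν₀ z₀ α x * ((((Lc ^ m : ℕ) : ℝ) ^ 4 / 2) * faceWt (ctrOff 4 (Lc ^ m)) (Lc ^ m) α x))))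
              + (comp (diagK fun z b => -(∑ α : Fin (3 + 1), ∑ x ∈ blockSitesF (Lc ^ m) (blk (Lc ^ m) (legSite (ctr 4 (Lc ^ m)) z b)), colH (coDressKBmAt (ctr 4 (Lc ^ m)) (Lc ^ m) (KInvStep (d := 3) (Lc ^ m) 0)) (Lc ^ m) μ₀ 0 α x * ((((Lc ^ m : ℕ) : ℝ) ^ 4 / 2) * faceWt (ctrOff 4 (Lc ^ m)) (Lc ^ m) α x))) (vertexOfK (coDressKBmAt (ctr 4 (Lc ^ m)) (Lc ^ m) (KInvStep (d := 3) (Lc ^ m) 0)) (Lc ^ m) (fun κ u => (((Lc ^ m : ℕ) : ℝ) ^ 4) • wilsonA 3 κ u + (-(((Lc ^ m : ℕ) : ℝ) ^ 8 / 2)) • symVhSAt (ctr 4 (Lc ^ m)) 3 (Lc ^ m) rfl κ u) ν₀ z₀)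
                - comp (vertexOfK (coDressKBmAt (ctr 4 (Lc ^ m)) (Lc ^ m) (KInvStep (d := 3) (Lc ^ m) 0)) (Lc ^ m) (fun κ u => (((Lc ^ m : ℕ) : ℝ) ^ 4) • wilsonA 3 κ u + (-(((Lc ^ m : ℕ) : ℝ) ^ 8 / 2)) • symVhSAt (ctr 4 (Lc ^ m)) 3 (Lc ^ m) rfl κ u) ν₀ z₀) (diagK fun z b => -(∑ α : Fin (3 + 1), ∑ x ∈ blockSitesF (Lc ^ m) (blk (Lc ^ m) (legSite (ctr 4 (Lc ^ m)) z b)), colH (coDressKBmAt (ctr 4 (Lc ^ m)) (Lc ^ m) (KInvStep (d := 3) (Lc ^ m) 0)) (Lc ^ m) μ₀ 0 α x * ((((Lc ^ m : ℕ) : ℝ) ^ 4 / 2) * faceWt (ctrOff 4 (Lc ^ m)) (Lc ^ m) α x))))))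
            - (((comp (diagK fun z b => -(∑ α : Fin (3 + 1), ∑ x ∈ blockSitesF (Lc ^ m) (blk (Lc ^ m) (legSite (ctr 4 (Lc ^ m)) z b)), colH (coDressKBmAt (ctr 4 (Lc ^ m)) (Lc ^ m) (KInvStep (d := 3) (Lc ^ m) 0)) (Lc ^ m) ν₀ z₀ α x * ((((Lc ^ m : ℕ) : ℝ) ^ 4 / 2) * faceWt (ctrOff 4 (Lc ^ m)) (Lc ^ m) α x))) (vertexOfK (coDressKBmAt (ctr 4 (Lc ^ m)) (Lc ^ m) (KInvStep (d := 3) (Lc ^ m) 0)) (Lc ^ m) (JsB12CombSh0 (Lc := Lc ^ m) hLc.pow N (symTablesAn1S2 3 (Lc ^ m) (cΛ m)) (cΛ m) (-(((Lc ^ m : ℕ) : ℝ) ^ 12 / 4)) 0).S μ₀ 0)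
                - comp (vertexOfK (coDressKBmAt (ctr 4 (Lc ^ m)) (Lc ^ m) (KInvStep (d := 3) (Lc ^ m) 0)) (Lc ^ m) (JsB12CombSh0 (Lc := Lc ^ m) hLc.pow N (symTablesAn1S2 3 (Lc ^ m) (cΛ m)) (cΛ m) (-(((Lc ^ m : ℕ) : ℝ) ^ 12 / 4)) 0).S μ₀ 0) (diagK fun z b => -(∑ α : Fin (3 + 1), ∑ x ∈ blockSitesF (Lc ^ m) (blk (Lc ^ m) (legSite (ctr 4 (Lc ^ m)) z b)), colH (coDressKBmAt (ctr 4 (Lc ^ m)) (Lc ^ m) (KInvStep (d := 3) (Lc ^ m) 0)) (Lc ^ m) ν₀ z₀ α x * ((((Lc ^ m : ℕ) : ℝ) ^ 4 / 2) * faceWt (ctrOff 4 (Lc ^ m)) (Lc ^ m) α x))))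
              + (comp (diagK fun z b => -(∑ α : Fin (3 + 1), ∑ x ∈ blockSitesF (Lc ^ m) (blk (Lc ^ m) (legSite (ctr 4 (Lc ^ m)) z b)), colH (coDressKBmAt (ctr 4 (Lc ^ m)) (Lc ^ m) (KInvStep (d := 3) (Lc ^ m) 0)) (Lc ^ m) μ₀ 0 α x * ((((Lc ^ m : ℕ) : ℝ) ^ 4 / 2) * faceWt (ctrOff 4 (Lc ^ m)) (Lc ^ m) α x))) (vertexOfK (coDressKBmAt (ctr 4 (Lc ^ m)) (Lc ^ m) (KInvStep (d := 3) (Lc ^ m) 0)) (Lc ^ m) (JsB12CombSh0 (Lc := Lc ^ m) hLc.pow N (symTablesAn1S2 3 (Lc ^ m) (cΛ m)) (cΛ m) (-(((Lc ^ m : ℕ) : ℝ) ^ 12 / 4)) 0).S ν₀ z₀)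
                - comp (vertexOfK (coDressKBmAt (ctr 4 (Lc ^ m)) (Lc ^ m) (KInvStep (d := 3) (Lc ^ m) 0)) (Lc ^ m) (JsB12CombSh0 (Lc := Lc ^ m) hLc.pow N (symTablesAn1S2 3 (Lc ^ m) (cΛ m)) (cΛ m) (-(((Lc ^ m : ℕ) : ℝ) ^ 12 / 4)) 0).S ν₀ z₀) (diagK fun z b => -(∑ α : Fin (3 + 1), ∑ x ∈ blockSitesF (Lc ^ m) (blk (Lc ^ m) (legSite (ctr 4 (Lc ^ m)) z b)), colH (coDressKBmAt (ctr 4 (Lc ^ m)) (Lc ^ m) (KInvStep (d := 3) (Lc ^ m) 0)) (Lc ^ m) μ₀ 0 α x * ((((Lc ^ m : ℕ) : ℝ) ^ 4 / 2) * faceWt (ctrOff 4 (Lc ^ m)) (Lc ^ m) α x)))))))))))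
        + (1 / 2) * (tr (comp (comp (comp (comp (coDressKBmAt (ctr 4 (Lc ^ m)) (Lc ^ m) (KInvStep (d := 3) (Lc ^ m) 0)) (Dsh (Lc ^ m))) (GcombSh (d := 3) (Lc ^ m) 0)) (vertexOfK (KInvStep (d := 3) (Lc ^ m) 0) (Lc ^ m) (JsB12CombSh0 (Lc := Lc ^ m) hLc.pow N (symTablesAn1S2 3 (Lc ^ m) (cΛ m)) (cΛ m) (-(((Lc ^ m : ℕ) : ℝ) ^ 12 / 4)) 0).S μ₀ 0)) (comp (GcombSh (d := 3) (Lc ^ m) 0) (vertexOfK (KInvStep (d := 3) (Lc ^ m) 0) (Lc ^ m) (JsB12CombSh0 (Lc := Lc ^ m) hLc.pow N (symTablesAn1S2 3 (Lc ^ m) (cΛ m)) (cΛ m) (-(((Lc ^ m : ℕ) : ℝ) ^ 12 / 4)) 0).S ν₀ z₀)))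
          + tr (comp (comp (coDressKBmAt (ctr 4 (Lc ^ m)) (Lc ^ m) (KInvStep (d := 3) (Lc ^ m) 0)) (vertexOfK (KInvStep (d := 3) (Lc ^ m) 0) (Lc ^ m) (JsB12CombSh0 (Lc := Lc ^ m) hLc.pow N (symTablesAn1S2 3 (Lc ^ m) (cΛ m)) (cΛ m) (-(((Lc ^ m : ℕ) : ℝ) ^ 12 / 4)) 0).S μ₀ 0)) (comp (comp (comp (coDressKBmAt (ctr 4 (Lc ^ m)) (Lc ^ m) (KInvStep (d := 3) (Lc ^ m) 0)) (Dsh (Lc ^ m))) (GcombSh (d := 3) (Lc ^ m) 0)) (vertexOfK (KInvStep (d := 3) (Lc ^ m) 0) (Lc ^ m) (JsB12CombSh0 (Lc := Lc ^ m) hLc.pow N (symTablesAn1S2 3 (Lc ^ m) (cΛ m)) (cΛ m) (-(((Lc ^ m : ℕ) : ℝ) ^ 12 / 4)) 0).S ν₀ z₀))))))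
        + ((1 / 2) * tadpole (coDressKBmAt (ctr 4 (Lc ^ m)) (Lc ^ m) (KInvStep (d := 3) (Lc ^ m) 0)) (comp (diagK fun z' b => ((Lc ^ m : ℕ) : ℝ) ^ 4 / 2 * bmGaugeAt (ctr 4 (Lc ^ m)) (colH (KInvStep (d := 3) (Lc ^ m) 0) (Lc ^ m) ν₀ z₀) (Lc ^ m) (legSite (ctr 4 (Lc ^ m)) z' b))
                (comp (diagK fun z' b => ((Lc ^ m : ℕ) : ℝ) ^ 4 / 2 * bmGaugeAt (ctr 4 (Lc ^ m)) (colH (KInvStep (d := 3) (Lc ^ m) 0) (Lc ^ m) μ₀ 0) (Lc ^ m) (legSite (ctr 4 (Lc ^ m)) z' b)) (Dsh (Lc ^ m))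
              - comp (Dsh (Lc ^ m)) (diagK fun z' b => ((Lc ^ m : ℕ) : ℝ) ^ 4 / 2 * bmGaugeAt (ctr 4 (Lc ^ m)) (colH (KInvStep (d := 3) (Lc ^ m) 0) (Lc ^ m) μ₀ 0) (Lc ^ m) (legSite (ctr 4 (Lc ^ m)) z' b)))
              - comp (comp (diagK fun z' b => ((Lc ^ m : ℕ) : ℝ) ^ 4 / 2 * bmGaugeAt (ctr 4 (Lc ^ m)) (colH (KInvStep (d := 3) (Lc ^ m) 0) (Lc ^ m) μ₀ 0) (Lc ^ m) (legSite (ctr 4 (Lc ^ m)) z' b)) (Dsh (Lc ^ m))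
              - comp (Dsh (Lc ^ m)) (diagK fun z' b => ((Lc ^ m : ℕ) : ℝ) ^ 4 / 2 * bmGaugeAt (ctr 4 (Lc ^ m)) (colH (KInvStep (d := 3) (Lc ^ m) 0) (Lc ^ m) μ₀ 0) (Lc ^ m) (legSite (ctr 4 (Lc ^ m)) z' b)))
                (diagK fun z' b => ((Lc ^ m : ℕ) : ℝ) ^ 4 / 2 * bmGaugeAt (ctr 4 (Lc ^ m)) (colH (KInvStep (d := 3) (Lc ^ m) 0) (Lc ^ m) ν₀ z₀) (Lc ^ m) (legSite (ctr 4 (Lc ^ m)) z' b))))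
        + ((1 / 2) * (bubble (coDressKBmAt (ctr 4 (Lc ^ m)) (Lc ^ m) (KInvStep (d := 3) (Lc ^ m) 0)) (vertexOfK (KInvStep (d := 3) (Lc ^ m) 0) (Lc ^ m) (JsB12CombSh0 (Lc := Lc ^ m) hLc.pow N (symTablesAn1S2 3 (Lc ^ m) (cΛ m)) (cΛ m) (-(((Lc ^ m : ℕ) : ℝ) ^ 12 / 4)) 0).S μ₀ 0) (comp (diagK fun z' b => ((Lc ^ m : ℕ) : ℝ) ^ 4 / 2 * bmGaugeAt (ctr 4 (Lc ^ m)) (colH (KInvStep (d := 3) (Lc ^ m) 0) (Lc ^ m) ν₀ z₀) (Lc ^ m) (legSite (ctr 4 (Lc ^ m)) z' b)) (Dsh (Lc ^ m))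
              - comp (Dsh (Lc ^ m)) (diagK fun z' b => ((Lc ^ m : ℕ) : ℝ) ^ 4 / 2 * bmGaugeAt (ctr 4 (Lc ^ m)) (colH (KInvStep (d := 3) (Lc ^ m) 0) (Lc ^ m) ν₀ z₀) (Lc ^ m) (legSite (ctr 4 (Lc ^ m)) z' b)))
            + bubble (coDressKBmAt (ctr 4 (Lc ^ m)) (Lc ^ m) (KInvStep (d := 3) (Lc ^ m) 0)) (comp (diagK fun z' b => ((Lc ^ m : ℕ) : ℝ) ^ 4 / 2 * bmGaugeAt (ctr 4 (Lc ^ m)) (colH (KInvStep (d := 3) (Lc ^ m) 0) (Lc ^ m) μ₀ 0) (Lc ^ m) (legSite (ctr 4 (Lc ^ m)) z' b)) (Dsh (Lc ^ m))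
              - comp (Dsh (Lc ^ m)) (diagK fun z' b => ((Lc ^ m : ℕ) : ℝ) ^ 4 / 2 * bmGaugeAt (ctr 4 (Lc ^ m)) (colH (KInvStep (d := 3) (Lc ^ m) 0) (Lc ^ m) μ₀ 0) (Lc ^ m) (legSite (ctr 4 (Lc ^ m)) z' b))) (vertexOfK (KInvStep (d := 3) (Lc ^ m) 0) (Lc ^ m) (JsB12CombSh0 (Lc := Lc ^ m) hLc.pow N (symTablesAn1S2 3 (Lc ^ m) (cΛ m)) (cΛ m) (-(((Lc ^ m : ℕ) : ℝ) ^ 12 / 4)) 0).S ν₀ z₀)))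
        + ((1 / 2) * bubble (coDressKBmAt (ctr 4 (Lc ^ m)) (Lc ^ m) (KInvStep (d := 3) (Lc ^ m) 0)) (comp (diagK fun z' b => ((Lc ^ m : ℕ) : ℝ) ^ 4 / 2 * bmGaugeAt (ctr 4 (Lc ^ m)) (colH (KInvStep (d := 3) (Lc ^ m) 0) (Lc ^ m) μ₀ 0) (Lc ^ m) (legSite (ctr 4 (Lc ^ m)) z' b)) (Dsh (Lc ^ m))
              - comp (Dsh (Lc ^ m)) (diagK fun z' b => ((Lc ^ m : ℕ) : ℝ) ^ 4 / 2 * bmGaugeAt (ctr 4 (Lc ^ m)) (colH (KInvStep (d := 3) (Lc ^ m) 0) (Lc ^ m) μ₀ 0) (Lc ^ m) (legSite (ctr 4 (Lc ^ m)) z' b))) (comp (diagK fun z' b => ((Lc ^ m : ℕ) : ℝ) ^ 4 / 2 * bmGaugeAt (ctr 4 (Lc ^ m)) (colH (KInvStep (d := 3) (Lc ^ m) 0) (Lc ^ m) ν₀ z₀) (Lc ^ m) (legSite (ctr 4 (Lc ^ m)) z' b)) (Dsh (Lc ^ m))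
              - comp (Dsh (Lc ^ m)) (diagK fun z' b => ((Lc ^ m : ℕ) : ℝ) ^ 4 / 2 * bmGaugeAt (ctr 4 (Lc ^ m)) (colH (KInvStep (d := 3) (Lc ^ m) 0) (Lc ^ m) ν₀ z₀) (Lc ^ m) (legSite (ctr 4 (Lc ^ m)) z' b)))))
    (hWrest : ∀ (m : ℕ) (μ₀ ν₀ : Fin 4) (z₀ : Site 4), Wrest m μ₀ ν₀ z₀
      = (1 / 2) * tadpole (coDressKBmAt (ctr 4 (Lc ^ m)) (Lc ^ m) (KInvStep (d := 3) (Lc ^ m) 0)) (W2SymOfK (KInvStep (d := 3) (Lc ^ m) 0) (Lc ^ m) (fun κ u => (((Lc ^ m : ℕ) : ℝ) ^ 4) • wilsonA 3 κ u + (-(((Lc ^ m : ℕ) : ℝ) ^ 8 / 2)) • symVhSAt (ctr 4 (Lc ^ m)) 3 (Lc ^ m) rfl κ u)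
              ((symTablesAn1S2 3 (Lc ^ m) (cΛ m)).M 0) (fun κ u κ' u' => (((Lc ^ m : ℕ) : ℝ) ^ 8) • wilsonW₂ 3 ((8 * (N : ℝ) ^ 2)⁻¹ • wsym22 N) κ u κ' u' + (-(((Lc ^ m : ℕ) : ℝ) ^ 12 / 4)) • symVh₂SAn1 3 (Lc ^ m) κ u κ' u')
              (M2Of 3 (Lc ^ m) (symTablesAn1S2 3 (Lc ^ m) (cΛ m)).mixFF 0) μ₀ 0 ν₀ z₀
            - vertex2OfK (KInvStep (d := 3) (Lc ^ m) 0) (Lc ^ m)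
              (fun κ u κ' u' => (((Lc ^ m : ℕ) : ℝ) ^ 8) • wilsonW₂ 3 ((8 * (N : ℝ) ^ 2)⁻¹ • wsym22 N) κ u κ' u' + (-(((Lc ^ m : ℕ) : ℝ) ^ 12 / 4)) • symVh₂SAn1 3 (Lc ^ m) κ u κ' u') μ₀ 0 ν₀ z₀))
    (hWmcol : ∀ (m : ℕ) (μ₀ ν₀ : Fin 4) (z₀ : Site 4), Wmcol m μ₀ ν₀ z₀
      = (1 / 2) * tadpole (coDressKBmAt (ctr 4 (Lc ^ m)) (Lc ^ m) (KInvStep (d := 3) (Lc ^ m) 0)) (((mixOfK (coDressKBmAt (ctr 4 (Lc ^ m)) (Lc ^ m) (KInvStep (d := 3) (Lc ^ m) 0)) (Lc ^ m) (M2Of 3 (Lc ^ m) (symTablesAn1S2 3 (Lc ^ m) (cΛ m)).mixFF 0) μ₀ 0 ν₀ z₀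
                - mixOfK (KInvStep (d := 3) (Lc ^ m) 0) (Lc ^ m) (M2Of 3 (Lc ^ m) (symTablesAn1S2 3 (Lc ^ m) (cΛ m)).mixFF 0) μ₀ 0 ν₀ z₀)
            + (mixOfK (coDressKBmAt (ctr 4 (Lc ^ m)) (Lc ^ m) (KInvStep (d := 3) (Lc ^ m) 0)) (Lc ^ m) (M2Of 3 (Lc ^ m) (symTablesAn1S2 3 (Lc ^ m) (cΛ m)).mixFF 0) ν₀ z₀ μ₀ 0
                - mixOfK (KInvStep (d := 3) (Lc ^ m) 0) (Lc ^ m) (M2Of 3 (Lc ^ m) (symTablesAn1S2 3 (Lc ^ m) (cΛ m)).mixFF 0) ν₀ z₀ μ₀ 0))))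
    (hWms : ∀ (m : ℕ) (μ₀ ν₀ : Fin 4) (z₀ : Site 4), Wms m μ₀ ν₀ z₀
      = (1 / 2) * tadpole (coDressKBmAt (ctr 4 (Lc ^ m)) (Lc ^ m) (KInvStep (d := 3) (Lc ^ m) 0)) (((mixOfK (coDressKBmAt (ctr 4 (Lc ^ m)) (Lc ^ m) (KInvStep (d := 3) (Lc ^ m) 0)) (Lc ^ m) (fun κ u ρ w => (if blk (Lc ^ m) (((Lc ^ m : ℕ) : ℤ) • w + (ctr 4 (Lc ^ m))) = blk (Lc ^ m) u then 2 * faceWt (ctrOff 4 (Lc ^ m)) (Lc ^ m) κ u else 0) • (symHessFFAt (ctr 4 (Lc ^ m)) (Lc ^ m)) ρ w) μ₀ 0 ν₀ z₀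
                + mixOfK (coDressKBmAt (ctr 4 (Lc ^ m)) (Lc ^ m) (KInvStep (d := 3) (Lc ^ m) 0)) (Lc ^ m) (fun κ u ρ w => (if blk (Lc ^ m) (((Lc ^ m : ℕ) : ℤ) • w + (ctr 4 (Lc ^ m))) = blk (Lc ^ m) u then 2 * faceWt (ctrOff 4 (Lc ^ m)) (Lc ^ m) κ u else 0) • (symHessFFAt (ctr 4 (Lc ^ m)) (Lc ^ m)) ρ w) ν₀ z₀ μ₀ 0)
              - (comp (diagK fun z b => ∑ α : Fin (3 + 1), ∑ x ∈ blockSitesF (Lc ^ m) (blk (Lc ^ m) (legSite (ctr 4 (Lc ^ m)) z b)), colH (coDressKBmAt (ctr 4 (Lc ^ m)) (Lc ^ m) (KInvStep (d := 3) (Lc ^ m) 0)) (Lc ^ m) μ₀ 0 α x * (2 * faceWt (ctrOff 4 (Lc ^ m)) (Lc ^ m) α x)) (vertexOfM (coDressKBmAt (ctr 4 (Lc ^ m)) (Lc ^ m) (KInvStep (d := 3) (Lc ^ m) 0)) (Lc ^ m) (symHessFFAt (ctr 4 (Lc ^ m)) (Lc ^ m)) ν₀ z₀)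
                + comp (diagK fun z b => ∑ α : Fin (3 + 1), ∑ x ∈ blockSitesF (Lc ^ m) (blk (Lc ^ m) (legSite (ctr 4 (Lc ^ m)) z b)), colH (coDressKBmAt (ctr 4 (Lc ^ m)) (Lc ^ m) (KInvStep (d := 3) (Lc ^ m) 0)) (Lc ^ m) ν₀ z₀ α x * (2 * faceWt (ctrOff 4 (Lc ^ m)) (Lc ^ m) α x)) (vertexOfM (coDressKBmAt (ctr 4 (Lc ^ m)) (Lc ^ m) (KInvStep (d := 3) (Lc ^ m) 0)) (Lc ^ m) (symHessFFAt (ctr 4 (Lc ^ m)) (Lc ^ m)) μ₀ 0)))))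
    (hWlamf : ∀ (m : ℕ) (μ₀ ν₀ : Fin 4) (z₀ : Site 4), Wlamf m μ₀ ν₀ z₀
      = (1 / 2) * tadpole (coDressKBmAt (ctr 4 (Lc ^ m)) (Lc ^ m) (KInvStep (d := 3) (Lc ^ m) 0)) ((((comp (diagK fun z b => -(∑ α : Fin (3 + 1), ∑ x ∈ blockSitesF (Lc ^ m) (blk (Lc ^ m) (legSite (ctr 4 (Lc ^ m)) z b)), colH (coDressKBmAt (ctr 4 (Lc ^ m)) (Lc ^ m) (KInvStep (d := 3) (Lc ^ m) 0)) (Lc ^ m) ν₀ z₀ α x * ((((Lc ^ m : ℕ) : ℝ) ^ 4 / 2) * faceWt (ctrOff 4 (Lc ^ m)) (Lc ^ m) α x))) (vertexOfK (coDressKBmAt (ctr 4 (Lc ^ m)) (Lc ^ m) (KInvStep (d := 3) (Lc ^ m) 0)) (Lc ^ m) (fun κ u => (((Lc ^ m : ℕ) : ℝ) ^ 4) • wilsonA 3 κ u + (-(((Lc ^ m : ℕ) : ℝ) ^ 8 / 2)) • symVhSAt (ctr 4 (Lc ^ m)) 3 (Lc ^ m) rfl κ u) μ₀ 0)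
                - comp (vertexOfK (coDressKBmAt (ctr 4 (Lc ^ m)) (Lc ^ m) (KInvStep (d := 3) (Lc ^ m) 0)) (Lc ^ m) (fun κ u => (((Lc ^ m : ℕ) : ℝ) ^ 4) • wilsonA 3 κ u + (-(((Lc ^ m : ℕ) : ℝ) ^ 8 / 2)) • symVhSAt (ctr 4 (Lc ^ m)) 3 (Lc ^ m) rfl κ u) μ₀ 0) (diagK fun z b => -(∑ α : Fin (3 + 1), ∑ x ∈ blockSitesF (Lc ^ m) (blk (Lc ^ m) (legSite (ctr 4 (Lc ^ m)) z b)), colH (coDressKBmAt (ctr 4 (Lc ^ m)) (Lc ^ m) (KInvStep (d := 3) (Lc ^ m) 0)) (Lc ^ m) ν₀ z₀ α x * ((((Lc ^ m : ℕ) : ℝ) ^ 4 / 2) * faceWt (ctrOff 4 (Lc ^ m)) (Lc ^ m) α x))))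
              + (comp (diagK fun z b => -(∑ α : Fin (3 + 1), ∑ x ∈ blockSitesF (Lc ^ m) (blk (Lc ^ m) (legSite (ctr 4 (Lc ^ m)) z b)), colH (coDressKBmAt (ctr 4 (Lc ^ m)) (Lc ^ m) (KInvStep (d := 3) (Lc ^ m) 0)) (Lc ^ m) μ₀ 0 α x * ((((Lc ^ m : ℕ) : ℝ) ^ 4 / 2) * faceWt (ctrOff 4 (Lc ^ m)) (Lc ^ m) α x))) (vertexOfK (coDressKBmAt (ctr 4 (Lc ^ m)) (Lc ^ m) (KInvStep (d := 3) (Lc ^ m) 0)) (Lc ^ m) (fun κ u => (((Lc ^ m : ℕ) : ℝ) ^ 4) • wilsonA 3 κ u + (-(((Lc ^ m : ℕ) : ℝ) ^ 8 / 2)) • symVhSAt (ctr 4 (Lc ^ m)) 3 (Lc ^ m) rfl κ u) ν₀ z₀)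
                - comp (vertexOfK (coDressKBmAt (ctr 4 (Lc ^ m)) (Lc ^ m) (KInvStep (d := 3) (Lc ^ m) 0)) (Lc ^ m) (fun κ u => (((Lc ^ m : ℕ) : ℝ) ^ 4) • wilsonA 3 κ u + (-(((Lc ^ m : ℕ) : ℝ) ^ 8 / 2)) • symVhSAt (ctr 4 (Lc ^ m)) 3 (Lc ^ m) rfl κ u) ν₀ z₀) (diagK fun z b => -(∑ α : Fin (3 + 1), ∑ x ∈ blockSitesF (Lc ^ m) (blk (Lc ^ m) (legSite (ctr 4 (Lc ^ m)) z b)), colH (coDressKBmAt (ctr 4 (Lc ^ m)) (Lc ^ m) (KInvStep (d := 3) (Lc ^ m) 0)) (Lc ^ m) μ₀ 0 α x * ((((Lc ^ m : ℕ) : ℝ) ^ 4 / 2) * faceWt (ctrOff 4 (Lc ^ m)) (Lc ^ m) α x))))))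
            - (((comp (diagK fun z b => -(∑ α : Fin (3 + 1), ∑ x ∈ blockSitesF (Lc ^ m) (blk (Lc ^ m) (legSite (ctr 4 (Lc ^ m)) z b)), colH (coDressKBmAt (ctr 4 (Lc ^ m)) (Lc ^ m) (KInvStep (d := 3) (Lc ^ m) 0)) (Lc ^ m) ν₀ z₀ α x * ((((Lc ^ m : ℕ) : ℝ) ^ 4 / 2) * faceWt (ctrOff 4 (Lc ^ m)) (Lc ^ m) α x))) (vertexOfK (coDressKBmAt (ctr 4 (Lc ^ m)) (Lc ^ m) (KInvStep (d := 3) (Lc ^ m) 0)) (Lc ^ m) (JsB12CombSh0 (Lc := Lc ^ m) hLc.pow N (symTablesAn1S2 3 (Lc ^ m) (cΛ m)) (cΛ m) (-(((Lc ^ m : ℕ) : ℝ) ^ 12 / 4)) 0).S μ₀ 0)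
                - comp (vertexOfK (coDressKBmAt (ctr 4 (Lc ^ m)) (Lc ^ m) (KInvStep (d := 3) (Lc ^ m) 0)) (Lc ^ m) (JsB12CombSh0 (Lc := Lc ^ m) hLc.pow N (symTablesAn1S2 3 (Lc ^ m) (cΛ m)) (cΛ m) (-(((Lc ^ m : ℕ) : ℝ) ^ 12 / 4)) 0).S μ₀ 0) (diagK fun z b => -(∑ α : Fin (3 + 1), ∑ x ∈ blockSitesF (Lc ^ m) (blk (Lc ^ m) (legSite (ctr 4 (Lc ^ m)) z b)), colH (coDressKBmAt (ctr 4 (Lc ^ m)) (Lc ^ m) (KInvStep (d := 3) (Lc ^ m) 0)) (Lc ^ m) ν₀ z₀ α x * ((((Lc ^ m : ℕ) : ℝ) ^ 4 / 2) * faceWt (ctrOff 4 (Lc ^ m)) (Lc ^ m) α x))))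
              + (comp (diagK fun z b => -(∑ α : Fin (3 + 1), ∑ x ∈ blockSitesF (Lc ^ m) (blk (Lc ^ m) (legSite (ctr 4 (Lc ^ m)) z b)), colH (coDressKBmAt (ctr 4 (Lc ^ m)) (Lc ^ m) (KInvStep (d := 3) (Lc ^ m) 0)) (Lc ^ m) μ₀ 0 α x * ((((Lc ^ m : ℕ) : ℝ) ^ 4 / 2) * faceWt (ctrOff 4 (Lc ^ m)) (Lc ^ m) α x))) (vertexOfK (coDressKBmAt (ctr 4 (Lc ^ m)) (Lc ^ m) (KInvStep (d := 3) (Lc ^ m) 0)) (Lc ^ m) (JsB12CombSh0 (Lc := Lc ^ m) hLc.pow N (symTablesAn1S2 3 (Lc ^ m) (cΛ m)) (cΛ m) (-(((Lc ^ m : ℕ) : ℝ) ^ 12 / 4)) 0).S ν₀ z₀)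
                - comp (vertexOfK (coDressKBmAt (ctr 4 (Lc ^ m)) (Lc ^ m) (KInvStep (d := 3) (Lc ^ m) 0)) (Lc ^ m) (JsB12CombSh0 (Lc := Lc ^ m) hLc.pow N (symTablesAn1S2 3 (Lc ^ m) (cΛ m)) (cΛ m) (-(((Lc ^ m : ℕ) : ℝ) ^ 12 / 4)) 0).S ν₀ z₀) (diagK fun z b => -(∑ α : Fin (3 + 1), ∑ x ∈ blockSitesF (Lc ^ m) (blk (Lc ^ m) (legSite (ctr 4 (Lc ^ m)) z b)), colH (coDressKBmAt (ctr 4 (Lc ^ m)) (Lc ^ m) (KInvStep (d := 3) (Lc ^ m) 0)) (Lc ^ m) μ₀ 0 α x * ((((Lc ^ m : ℕ) : ℝ) ^ 4 / 2) * faceWt (ctrOff 4 (Lc ^ m)) (Lc ^ m) α x))))))))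
    -- the m-INDEPENDENT prices (constants bound BEFORE `∀ m`)
    {Clead Crest Cmcol Cms Clamf : ℝ}
    (hAlead : ∀ m a e, AbsMoment₂ (Wlead m a e)) (hBlead : ∀ m, |secondMoment (Wlead m) μ ν| ≤ Clead)
    (hArest : ∀ m a e, AbsMoment₂ (Wrest m a e)) (hBrest : ∀ m, |secondMoment (Wrest m) μ ν| ≤ Crest)
    (hAmcol : ∀ m a e, AbsMoment₂ (Wmcol m a e)) (hBmcol : ∀ m, |secondMoment (Wmcol m) μ ν| ≤ Cmcol)
    (hAms : ∀ m a e, AbsMoment₂ (Wms m a e)) (hBms : ∀ m, |secondMoment (Wms m) μ ν| ≤ Cms)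
    (hAlamf : ∀ m a e, AbsMoment₂ (Wlamf m a e)) (hBlamf : ∀ m, |secondMoment (Wlamf m) μ ν| ≤ Clamf)
    :
    ∀ m : ℕ, 1 ≤ m → |secondMoment (fun (c e : Fin 4) (z : Site 4) =>
        TshotOf Lc (JcOfTabs hLc N (fun k => symTablesAn1S2 3 (Lc ^ k) (cΛ k)) cΛ cB) m c e z
          - hessKer (coDressKBmAt (toSite (r (Lc ^ m))) (Lc ^ m) (KInvStep (d := 3) (Lc ^ m) 0))
              (vertexOfK (coDressKBmAt (toSite (r (Lc ^ m))) (Lc ^ m) (KInvStep (d := 3) (Lc ^ m) 0)) (Lc ^ m) (S (Lc ^ m)))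
              (vertex2OfK (coDressKBmAt (toSite (r (Lc ^ m))) (Lc ^ m) (KInvStep (d := 3) (Lc ^ m) 0)) (Lc ^ m)
                (fun κ u κ' u' => (((Lc ^ m : ℕ) : ℝ) ^ 8) • wilsonW₂ 3 ((8 * (N : ℝ) ^ 2)⁻¹ • wsym22 N) κ u κ' u' + (-(((Lc ^ m : ℕ) : ℝ) ^ 12 / 4)) • symVh₂SAn1 3 (Lc ^ m) κ u κ' u')) c e z) μ ν|
      ≤ Clead + Crest + Cmcol + Cms + Clamf := by
  intro m _hm
  have hL1 : 1 < Lc := hL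
  have hr : r (Lc ^ m) = ctrOff 4 (Lc ^ m) := hrpin (Lc ^ m)
  have hcBm : cB = fun k => -(((Lc ^ k : ℕ) : ℝ) ^ 12 / 4) := funext hcB
  have hS : S (Lc ^ m) = (JsB12CombSh0 (Lc := Lc ^ m) hLc.pow N (symTablesAn1S2 3 (Lc ^ m) (cΛ m)) (cΛ m) (-(((Lc ^ m : ℕ) : ℝ) ^ 12 / 4)) 0).S := by
    subst hSpin
    simp only [dif_pos hLc.pow, Nat.log_pow hL1, hcB m]
  rw [hr, hS, hcBm]
  exact abs_secondMoment_chartDefect_scales_le_of_five_rows hLc hτ ho hN c cΛ μ ν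
    Wlead Wrest Wmcol Wms Wlamf
    hWlead hWrest hWmcol hWms hWlamf
    hAlead hBlead hArest hBrest hAmcol hBmcol hAms hBms hAlamf hBlamf m

end Summit.QuantumFields.BalabanUV.Beta.D1BFx.ChartDefectHeadEnd

end
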